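import Summits.CriticalPhenomena.PercolationContinuityZ3.Theorems.PercNearOneGluingNoHeavyLowerTailOrientedAntipodalHallAcyclic
import Summits.CriticalPhenomena.PercolationContinuityZ3.Theorems.PercNearOneGluingNoHeavyLowerTailSunflowerDisjointDerangement
import HarnessLib
import HarnessLib.Audit

/-!
# `NoHeavyLowerTail` (crux stmt-CriticalPhenomena-4575), abstract sunflower cubic: CROSS-CUBE ROUTING of the decided-spectator bads
# (the decided-spectator half of the interval Hall conjecture (INT∀) — THEOREM A of the memo; prim-l12-p2 gen 29)

Support file (`--supports stmt-CriticalPhenomena-4575`).  Everything here is PROVED; no new definitions.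
Memo: run/shared/lean/prim/prim-l12/prim-l12-p2/FINDING-g29-RECTANGLE-REDUCTION.md §4.4.

SETTING (as in `…OrientedAntipodalHall`): `f : Finset α → Lab k` monotone for `B < Cᵢ < A` (a `k`-petal sunflower labelling of `2^α`).
A SLOT is an ordered partition `(K; S; T)` of the ground set with `f K = A` or `B`, `f S = A`, `f T = B`; its INTERVAL is `[T, T ∪ S]`.
A TOP-SPECTATOR BAD is a pair `(X, P)`: `f X = A` and `{P, Xᶜ \\ P}` is an antipodal bad of the cube `Xᶜ` (two different petals),
oriented so that `P` carries the petal of larger index (any linear order of the petals would do).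

**Theorem (`exists_injective_blackSlot_above`).**  Every finite family `𝔇` of top-spectator bads admits an INJECTIVE assignment
`(X, P) ↦ (K, T)` with `f K = A`, `f T = B`, `f ((K ∪ T)ᶜ) = A` — so `(K; (K ∪ T)ᶜ; T)` is a slot with a TOP spectator — and
`P ⊆ K ⊆ Xᶜ`, `T ⊆ X`, i.e. the point `X` lies in the slot's interval `[T, Kᶜ]` and the spectator `K` absorbs the designated half `P`.

*Proof (two levels).*  Level 1: for each `X`, prim-ineq-gen-3's oriented antipodal Hall theorem for the transitive tournament
(`exists_injective_good_above_transitiveTournament`) in the cube `Xᶜ` assigns to the bads `(X, P) ∈ 𝔇` distinct goods `K ⊇ P` of that cube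
(`f K = A`, `f (Xᶜ \\ K) = B`).  Level 2: for each `K`, the white parts `Y` of the goods of the cube `Kᶜ` (`f Y = B`, `f (Kᶜ \\ Y) = A`) form a
DOWN-SET, and the bads routed to `K` are indexed injectively by `Y = Kᶜ \\ X`; the disjoint-derangement lemma
(`SunflowerPartition.exists_injective_disjoint_of_isLowerSet`, Harris–Kleitman twice) moves each such `Y` to a disjoint member `T` of the same
down-set, whence `T ⊆ X` and `(K; Kᶜ \\ T; T)` is a slot; decoding `K ↦ Y ↦ X ↦ P` gives injectivity.  (The bottom-spectator bads `(X, P)`,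
`f X = B`, are served injectively by the slots `(Xᶜ \\ K; K; X)` — the goods of their own cube re-read — which have BOTTOM spectators; so all
bads with a decided block are routed simultaneously.  The rainbow half of (INT∀) remains open.)
-/

namespace Summit.CriticalPhenomena.PercolationContinuityZ3.Theorems

namespace OrientedAntipodalHall

open Finset AntipodalStrongHarris AntipodalStrongHarris.Lab

variable {α : Type*} [DecidableEq α] [Fintype α] {k : ℕ}

/-- The white parts of the goods of the cube `Kᶜ` form a down-set. [this work] -/
theorem isLowerSet_whiteParts {f : Finset α → Lab k} (hf : ∀ ⦃X Y : Finset α⦄, X ⊆ Y → f X ≤ f Y) (K : Finset α) :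
    IsLowerSet ((univ.filter fun Y : Finset α => Y ⊆ Kᶜ ∧ f Y = bot ∧ f (Kᶜ \ Y) = top : Finset (Finset α)) : Set (Finset α)) := by
  intro Y Y' hY'Y hY
  rw [mem_coe, mem_filter] at hY ⊢
  obtain ⟨-, hYK, hYbot, hYtop⟩ := hY
  refine ⟨mem_univ _, hY'Y.trans hYK, ?_, ?_⟩
  · have h := hf hY'Y
    rw [hYbot, le_def] at h
    rcases h with h | h | h
    · exact h
    · exact absurd h (by simp)
    · exact h
  · have h := hf (sdiff_subset_sdiff (Subset.refl Kᶜ) hY'Y)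
    rw [hYtop, le_def] at h
    rcases h with h | h | h
    · exact absurd h (by simp)
    · exact h
    · exact h.symm

/-- **Cross-cube routing of the top-spectator bads** (THEOREM A of the memo, black case): an injective assignment of slots
`(K; (K ∪ T)ᶜ; T)` with top spectator `K ⊇ P`, `K ⊆ Xᶜ`, and bottom block `T ⊆ X`. [this work] -/
theorem exists_injective_blackSlot_above {f : Finset α → Lab k} (hf : ∀ ⦃X Y : Finset α⦄, X ⊆ Y → f X ≤ f Y)
    (𝔇 : Finset (Finset α × Finset α)) (i j : Finset α × Finset α → Fin k)
    (htop : ∀ d ∈ 𝔇, f d.1 = top) (hsub : ∀ d ∈ 𝔇, d.2 ⊆ d.1ᶜ)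
    (hi : ∀ d ∈ 𝔇, f d.2 = petal (i d)) (hj : ∀ d ∈ 𝔇, f (d.1ᶜ \ d.2) = petal (j d)) (hlt : ∀ d ∈ 𝔇, j d < i d) :
    ∃ Ψ : ↥𝔇 → Finset α × Finset α, Function.Injective Ψ ∧
      ∀ d : ↥𝔇, f (Ψ d).1 = top ∧ f (Ψ d).2 = bot ∧ f ((Ψ d).1 ∪ (Ψ d).2)ᶜ = top ∧
        (d : Finset α × Finset α).2 ⊆ (Ψ d).1 ∧ (Ψ d).1 ⊆ (d : Finset α × Finset α).1ᶜ ∧ (Ψ d).2 ⊆ (d : Finset α × Finset α).1 := by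
  classical
  -- Level 1: for each top set `X`, gen-3's injective goods above the halves `P` with `(X,P) ∈ 𝔇`, in the cube `Xᶜ`.
  let DX : Finset α → Finset (Finset α) := fun X => (𝔇.filter fun d => d.1 = X).image Prod.snd
  have hDX : ∀ X P, P ∈ DX X ↔ (X, P) ∈ 𝔇 := by
    intro X P
    simp only [DX, mem_image, mem_filter, Prod.exists]
    constructor
    · rintro ⟨X', P', ⟨hd, hX'⟩, hP'⟩
      subst hX'; subst hP'; exact hd
    · intro hd; exact ⟨X, P, ⟨hd, rfl⟩, rfl⟩
  have lvl1 : ∀ X : Finset α, ∃ φ : ↥(DX X) → Finset α, Function.Injective φ ∧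
      ∀ P : ↥(DX X), (P : Finset α) ⊆ φ P ∧ φ P ⊆ Xᶜ ∧ f (φ P) = top ∧ f (Xᶜ \ φ P) = bot := by
    intro X
    exact exists_injective_good_above_transitiveTournament Xᶜ hf (DX X) (fun P => i (X, P)) (fun P => j (X, P))
      (fun P hP => hsub _ ((hDX X P).1 hP)) (fun P hP => hi _ ((hDX X P).1 hP)) (fun P hP => hj _ ((hDX X P).1 hP))
      (fun P hP => hlt _ ((hDX X P).1 hP))
  choose φ hφinj hφ using lvl1
  -- Level 2: for each top spectator `K`, a disjoint derangement of the white parts of the goods of `Kᶜ`.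
  let W : Finset α → Finset (Finset α) := fun K => univ.filter fun Y : Finset α => Y ⊆ Kᶜ ∧ f Y = bot ∧ f (Kᶜ \ Y) = top
  have lvl2 : ∀ K : Finset α, ∃ π : ↥(W K) → ↥(W K), Function.Injective π ∧ ∀ Y : ↥(W K), Disjoint ((π Y : ↥(W K)) : Finset α) (Y : Finset α) :=
    fun K => SunflowerPartition.exists_injective_disjoint_of_isLowerSet (W K) (isLowerSet_whiteParts hf K)
  choose π hπinj hπ using lvl2
  -- the assignment
  have hmemDX : ∀ d : ↥𝔇, (d : Finset α × Finset α).2 ∈ DX (d : Finset α × Finset α).1 := by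
    rintro ⟨⟨X, P⟩, hd⟩
    exact (hDX X P).2 hd
  let K : ↥𝔇 → Finset α := fun d => φ (d : Finset α × Finset α).1 ⟨(d : Finset α × Finset α).2, hmemDX d⟩
  have hK : ∀ d : ↥𝔇, (d : Finset α × Finset α).2 ⊆ K d ∧ K d ⊆ (d : Finset α × Finset α).1ᶜ ∧ f (K d) = top ∧
      f ((d : Finset α × Finset α).1ᶜ \ K d) = bot := fun d => hφ _ ⟨_, hmemDX d⟩
  let Y : ↥𝔇 → Finset α := fun d => (K d)ᶜ \ (d : Finset α × Finset α).1
  have hXK : ∀ d : ↥𝔇, (d : Finset α × Finset α).1 ⊆ (K d)ᶜ := by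
    intro d
    have h := (hK d).2.1
    intro a ha
    rw [mem_compl]
    intro haK
    exact (mem_compl.1 (h haK)) ha
  have hYeq : ∀ d : ↥𝔇, Y d = (d : Finset α × Finset α).1ᶜ \ K d := by
    intro d; ext a; simp only [Y, mem_sdiff, mem_compl]; tauto
  have hY : ∀ d : ↥𝔇, Y d ∈ W (K d) := by
    intro d
    rw [mem_filter]
    refine ⟨mem_univ _, sdiff_subset, ?_, ?_⟩
    · rw [hYeq]; exact (hK d).2.2.2
    · have : (K d)ᶜ \ Y d = (d : Finset α × Finset α).1 := by
        simp only [Y]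
        rw [sdiff_sdiff_right_self, inf_eq_inter, inter_eq_right.2 (hXK d)]
      rw [this]; exact htop _ d.2
  let T : ↥𝔇 → Finset α := fun d => ((π (K d) ⟨Y d, hY d⟩ : ↥(W (K d))) : Finset α)
  have hT : ∀ d : ↥𝔇, T d ∈ W (K d) := fun d => (π (K d) ⟨Y d, hY d⟩).2
  have hTdisj : ∀ d : ↥𝔇, Disjoint (T d) (Y d) := fun d => hπ (K d) ⟨Y d, hY d⟩
  refine ⟨fun d => (K d, T d), ?_, ?_⟩
  · -- injectivity: K determines the cube, T determines Y (π injective), Y determines X, K and X determine P (φ injective)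
    intro d₁ d₂ h
    have hKeq : K d₁ = K d₂ := congrArg Prod.fst h
    have hTeq : T d₁ = T d₂ := congrArg Prod.snd h
    -- transport along hKeq
    have πval_congr : ∀ (K₁ K₂ : Finset α), K₁ = K₂ → ∀ (y : Finset α) (h₁ : y ∈ W K₁) (h₂ : y ∈ W K₂),
        ((π K₁ ⟨y, h₁⟩ : ↥(W K₁)) : Finset α) = ((π K₂ ⟨y, h₂⟩ : ↥(W K₂)) : Finset α) := by
      intro K₁ K₂ e; subst e; intro y h₁ h₂; rfl
    have hYeq' : Y d₁ = Y d₂ := by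
      have h1 : Y d₁ ∈ W (K d₂) := hKeq ▸ hY d₁
      have e1 : T d₁ = ((π (K d₂) ⟨Y d₁, h1⟩ : ↥(W (K d₂))) : Finset α) := πval_congr _ _ hKeq _ (hY d₁) h1
      have e2 : ((π (K d₂) ⟨Y d₁, h1⟩ : ↥(W (K d₂))) : Finset α) = ((π (K d₂) ⟨Y d₂, hY d₂⟩ : ↥(W (K d₂))) : Finset α) := by
        rw [← e1, hTeq]
      have e3 := hπinj (K d₂) (Subtype.ext e2)
      exact congrArg Subtype.val e3
    have hXeq : (d₁ : Finset α × Finset α).1 = (d₂ : Finset α × Finset α).1 := by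
      have e₁ : (K d₁)ᶜ \ Y d₁ = (d₁ : Finset α × Finset α).1 := by
        simp only [Y]; rw [sdiff_sdiff_right_self, inf_eq_inter, inter_eq_right.2 (hXK d₁)]
      have e₂ : (K d₂)ᶜ \ Y d₂ = (d₂ : Finset α × Finset α).1 := by
        simp only [Y]; rw [sdiff_sdiff_right_self, inf_eq_inter, inter_eq_right.2 (hXK d₂)]
      rw [← e₁, ← e₂, hKeq, hYeq']
    have hPeq : (d₁ : Finset α × Finset α).2 = (d₂ : Finset α × Finset α).2 := by
      have : ∀ (X₁ X₂ : Finset α) (e : X₁ = X₂) (P₁ : ↥(DX X₁)) (P₂ : ↥(DX X₂)),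
          φ X₁ P₁ = φ X₂ P₂ → (P₁ : Finset α) = P₂ := by
        intro X₁ X₂ e P₁ P₂ hh; subst e; exact congrArg Subtype.val (hφinj X₁ hh)
      exact this _ _ hXeq ⟨_, hmemDX d₁⟩ ⟨_, hmemDX d₂⟩ hKeq
    exact Subtype.ext (Prod.ext hXeq hPeq)
  · intro d
    obtain ⟨-, hTK, hTbot, hTtop⟩ := mem_filter.1 (hT d)
    refine ⟨(hK d).2.2.1, hTbot, ?_, (hK d).1, (hK d).2.1, ?_⟩
    · have : (K d ∪ T d)ᶜ = (K d)ᶜ \ T d := by ext a; simp [mem_sdiff, mem_compl]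
      rw [this]; exact hTtop
    · -- T ⊆ Kᶜ, T disjoint from Y = Kᶜ \ X, hence T ⊆ X
      intro a ha
      have haK : a ∈ (K d)ᶜ := hTK ha
      by_contra hax
      have haY : a ∈ Y d := by simp only [Y, mem_sdiff]; exact ⟨haK, hax⟩
      exact (Finset.disjoint_left.1 (hTdisj d)) ha haY

/-- **Routing of the bottom-spectator bads** (THEOREM A of the memo, white case): the goods of the bad's own cube re-read — an injective
assignment of slots `(K; S; T)` with BOTTOM spectator `K`, `S ⊇ P`, and bottom block `T = X` (so `X` is the bottom of the slot's interval).
Output coded as `(K, S)`; the bottom block is `(K ∪ S)ᶜ = X`. [this work] -/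
theorem exists_injective_whiteSlot_above {f : Finset α → Lab k} (hf : ∀ ⦃X Y : Finset α⦄, X ⊆ Y → f X ≤ f Y)
    (𝔇 : Finset (Finset α × Finset α)) (i j : Finset α × Finset α → Fin k)
    (hsub : ∀ d ∈ 𝔇, d.2 ⊆ d.1ᶜ)
    (hi : ∀ d ∈ 𝔇, f d.2 = petal (i d)) (hj : ∀ d ∈ 𝔇, f (d.1ᶜ \ d.2) = petal (j d)) (hlt : ∀ d ∈ 𝔇, j d < i d) :
    ∃ Ψ : ↥𝔇 → Finset α × Finset α, Function.Injective Ψ ∧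
      ∀ d : ↥𝔇, f (Ψ d).1 = bot ∧ f (Ψ d).2 = top ∧ ((Ψ d).1 ∪ (Ψ d).2)ᶜ = (d : Finset α × Finset α).1 ∧
        (d : Finset α × Finset α).2 ⊆ (Ψ d).2 ∧ (Ψ d).2 ⊆ (d : Finset α × Finset α).1ᶜ := by
  classical
  let DX : Finset α → Finset (Finset α) := fun X => (𝔇.filter fun d => d.1 = X).image Prod.snd
  have hDX : ∀ X P, P ∈ DX X ↔ (X, P) ∈ 𝔇 := by
    intro X P
    simp only [DX, mem_image, mem_filter, Prod.exists]
    constructor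
    · rintro ⟨X', P', ⟨hd, hX'⟩, hP'⟩
      subst hX'; subst hP'; exact hd
    · intro hd; exact ⟨X, P, ⟨hd, rfl⟩, rfl⟩
  have lvl1 : ∀ X : Finset α, ∃ φ : ↥(DX X) → Finset α, Function.Injective φ ∧
      ∀ P : ↥(DX X), (P : Finset α) ⊆ φ P ∧ φ P ⊆ Xᶜ ∧ f (φ P) = top ∧ f (Xᶜ \ φ P) = bot := by
    intro X
    exact exists_injective_good_above_transitiveTournament Xᶜ hf (DX X) (fun P => i (X, P)) (fun P => j (X, P))
      (fun P hP => hsub _ ((hDX X P).1 hP)) (fun P hP => hi _ ((hDX X P).1 hP)) (fun P hP => hj _ ((hDX X P).1 hP))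
      (fun P hP => hlt _ ((hDX X P).1 hP))
  choose φ hφinj hφ using lvl1
  have hmemDX : ∀ d : ↥𝔇, (d : Finset α × Finset α).2 ∈ DX (d : Finset α × Finset α).1 := by
    rintro ⟨⟨X, P⟩, hd⟩
    exact (hDX X P).2 hd
  let S : ↥𝔇 → Finset α := fun d => φ (d : Finset α × Finset α).1 ⟨(d : Finset α × Finset α).2, hmemDX d⟩
  have hS : ∀ d : ↥𝔇, (d : Finset α × Finset α).2 ⊆ S d ∧ S d ⊆ (d : Finset α × Finset α).1ᶜ ∧ f (S d) = top ∧
      f ((d : Finset α × Finset α).1ᶜ \ S d) = bot := fun d => hφ _ ⟨_, hmemDX d⟩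
  refine ⟨fun d => ((d : Finset α × Finset α).1ᶜ \ S d, S d), ?_, ?_⟩
  · intro d₁ d₂ h
    have hSeq : S d₁ = S d₂ := congrArg Prod.snd h
    have hKeq : (d₁ : Finset α × Finset α).1ᶜ \ S d₁ = (d₂ : Finset α × Finset α).1ᶜ \ S d₂ := congrArg Prod.fst h
    have hXc : ∀ d : ↥𝔇, ((d : Finset α × Finset α).1ᶜ \ S d) ∪ S d = (d : Finset α × Finset α).1ᶜ :=
      fun d => sdiff_union_of_subset (hS d).2.1
    have hXeq : (d₁ : Finset α × Finset α).1 = (d₂ : Finset α × Finset α).1 := by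
      have e : (d₁ : Finset α × Finset α).1ᶜ = (d₂ : Finset α × Finset α).1ᶜ := by rw [← hXc d₁, ← hXc d₂, hKeq, hSeq]
      exact compl_injective e
    have hPeq : (d₁ : Finset α × Finset α).2 = (d₂ : Finset α × Finset α).2 := by
      have : ∀ (X₁ X₂ : Finset α) (e : X₁ = X₂) (P₁ : ↥(DX X₁)) (P₂ : ↥(DX X₂)),
          φ X₁ P₁ = φ X₂ P₂ → (P₁ : Finset α) = P₂ := by
        intro X₁ X₂ e P₁ P₂ hh; subst e; exact congrArg Subtype.val (hφinj X₁ hh)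
      exact this _ _ hXeq ⟨_, hmemDX d₁⟩ ⟨_, hmemDX d₂⟩ hSeq
    exact Subtype.ext (Prod.ext hXeq hPeq)
  · intro d
    refine ⟨(hS d).2.2.2, (hS d).2.2.1, ?_, (hS d).1, (hS d).2.1⟩
    rw [sdiff_union_of_subset (hS d).2.1, compl_compl]

end OrientedAntipodalHall

end Summit.CriticalPhenomena.PercolationContinuityZ3.Theorems
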